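/-
Copyright (c) 2026. All rights reserved.
Released under Apache 2.0 license as described in the file LICENSE.
-/
import Literature.NumberTheory.Weil1964.ArchDualPairThetaMajorantsInr
import Literature.NumberTheory.Weil1964.AdelicCompactFamilyDominatedConj
import HarnessLib

/-!
# Lemme 5 for the second factor `1 × U(W)` of the unitary dual pair IN A CONJUGATED POLARISATION

Sequel of `ArchDualPairThetaMajorantsInr` ∕ `…InrSigns` (Weil's Lemme 5 [Weil1964, Chap. III n° 41 p. 194] for the
family `u ↦ ω_ψ(s_pair(1, u))` of the diagonal unitary dual pair of [GelbartRogawski1991] §3.1, no condition on `V`)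
and of `AdelicCompactFamilyDominatedConj` (the decay-data transport of Lemme 5 under conjugation by a fixed
`q ∈ Mp_ψ(𝕎_𝔸)ᶜᵒⁿᵗ`).  The Siegel–Weil ∕ Rallis engine of cell hodgecm-mathlib reads the `W□`-member of the doubled
dual pair in the polarisation `V ⊗ W^∇` — through implementers over `conj(δ♮) ∘ ι(1 ⊗ ·)`, `δ♮` Li's rational frame
element — so the family it must dominate is `{ω(q · s□_pair(1, c) · q⁻¹)Φ : c ∈ C}`, `q` a lift of `δ♮`
([Weil1965, Chap. V n° 47 Lemme 20, n° 50]).  This file states that family's Lemme 5: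

* §1 generic `E/F` (`F` totally real, ANY continuous compatible splitting `s`, ANY `q`):
  `exists_piSchwartzBruhat_dominating_omega_conj_pairSplitting_inr` (one second-factor `KAK` input per real place)
  and `…_of_signs` (one sign fact on `t_W` per real place; nothing on `t_V`);
* §2 the CM pin: `exists_piSchwartzBruhat_dominating_conj_cmPairSplitting_inr_of_signs`;
* §3 `M = 2` (a hermitian PLANE, e.g. `W ⊕ W⁻`): **`exists_piSchwartzBruhat_dominating_conj_cmPairSplitting_inr_two` —
  no sign hypothesis, any `q`.**

KERNEL only: no definition, no cited statement enters as a hypothesis.  HC_CM is proved only modulo the printed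
citations until rung 0 closes; nothing here is about Hodge classes.

## References

* [Weil1964] A. Weil, Acta Math. 111 (1964), Chap. III n° 41, Lemme 5 p. 194, Théorème 6 (1) p. 193.
* [Weil1965] A. Weil, Acta Math. 113 (1965), Chap. V n° 47 Lemme 20, n° 50.
* [GelbartRogawski1991] S. Gelbart, J. Rogawski, Invent. Math. 105 (1991), §3.1 Prop. 3.1.1 p. 455.
* [KonnoKonno2007] K. Konno, T. Konno, Kyushu J. Math. 61 (2007), §3.1 (3.1).
* [MoeglinVignerasWaldspurger1987] C. Mœglin, M.-F. Vignéras, J.-L. Waldspurger, LNM 1291 (1987), Ch. 1 I.17.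
* [Folland1989] G. B. Folland, *Harmonic Analysis in Phase Space* (1989), §4.2 (4.24)–(4.26) pp. 177–178, Prop. (4.39).
* [Knapp2002] A. W. Knapp, *Lie Groups Beyond an Introduction*, 2nd ed. (2002), Thm 7.39.
-/

noncomputable section

open scoped Matrix Real Classical ComplexConjugate
open Complex NumberField NumberField.InfinitePlace NumberField.mixedEmbedding IsDedekindDomain
open Literature.NumberTheory.Automorphic Literature.NumberTheory.Automorphic.UnitaryGroup
open Literature.RepresentationTheory.HeisenbergGroup Literature.Analysis.SegalBargmann
open Literature.RepresentationTheory.KonnoKonno2007 Literature.RepresentationTheory.KonnoKonno2007.RealDualPair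

namespace Literature.NumberTheory.Weil1964

/-! ## §1 Generic `E/F` -/

section Pair

variable {F : Type} [Field F] [NumberField F] (E : Type) [Field E] [NumberField E] [Algebra F E] (c : E ≃ₐ[F] E)
  (N M : ℕ) {m : ℕ} (e : Fin N × Fin M ≃ Fin m)
  (tV : Fin N → F) (tW : Fin M → F) {JV : Matrix (Fin N) (Fin N) E} {JW : Matrix (Fin M) (Fin M) E}
  (hJV : JV = (Matrix.diagonal tV).map (algebraMap F E)) (hJW : JW = (Matrix.diagonal tW).map (algebraMap F E))
  {P Q R S : {v : InfinitePlace F // v.IsReal} → Type*} [∀ v, Fintype (P v)] [∀ v, DecidableEq (P v)]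
  [∀ v, Fintype (Q v)] [∀ v, DecidableEq (Q v)] [∀ v, Fintype (R v)] [∀ v, DecidableEq (R v)]
  [∀ v, Fintype (S v)] [∀ v, DecidableEq (S v)]
  [IsTotallyReal F] [Algebra.IsQuadraticExtension F E] {δ : E} (hcδ : c δ = -δ) (hδ : δ ≠ 0) {d : F}
  (hd : δ * δ = algebraMap F E d) (hV : (Matrix.diagonal tV).IsSymm) (hW : (Matrix.diagonal tW).IsSymm)

/-- **Weil's Lemme 5 (pointwise adelic form) for the SECOND factor of the unitary dual pair READ IN A CONJUGATED
POLARISATION — no condition on `V`.**  Same data as ★ `exists_piSchwartzBruhat_dominating_omega_pairSplitting_inr`,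
plus a FIXED `q ∈ Mp_ψ(𝕎_𝔸)ᶜᵒⁿᵗ`: for every `Φ ∈ 𝒮(𝔸_Fⁿ)` and every compact `C ⊆ U(J_W)(𝔸_F)` there is ONE real
non-negative `Φ₀ ∈ 𝒮(𝔸_Fⁿ)` with `‖(ω_ψ(q · s_pair(1, u) · q⁻¹)Φ)(x)‖ ≤ (Φ₀ x).re` for all `u ∈ C` and `x ∈ 𝔸_Fⁿ`
(★ `exists_piSchwartzBruhat_dominating_omega_conj_comp_of_kakData`).
[cite: Weil1964, Chap. III n° 41, Lemme 5 p. 194]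
[cite: Weil1965, Chap. V n° 47, n° 50]
[cite: GelbartRogawski1991, §3.1 Prop. 3.1.1 p. 455]
[cite: Folland1989, §4.2 (4.24)–(4.26) pp. 177–178, Prop. (4.39) pp. 183–184] -/
theorem exists_piSchwartzBruhat_dominating_omega_conj_pairSplitting_inr (hc : c ≠ 1)
    (wOf : {v : InfinitePlace F // v.IsReal} → {w : InfinitePlace E // w.IsComplex})
    (hw : ∀ v, c • (wOf v).1 = (wOf v).1) (hover : ∀ v, (wOf v).1.comap (algebraMap F E) = v.1)
    (εV : ∀ v, Fin N ≃ P v ⊕ Q v) (εW : ∀ v, Fin M ≃ R v ⊕ S v)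
    {DV : {v : InfinitePlace F // v.IsReal} → Fin N → ℝ} {DW : {v : InfinitePlace F // v.IsReal} → Fin M → ℝ}
    (hDV0 : ∀ v i, DV v i ≠ 0) (hDW0 : ∀ v j, DW v j ≠ 0) {cV cW : {v : InfinitePlace F // v.IsReal} → ℝ}
    (hcV : ∀ v, cV v ≠ 0) (hcW : ∀ v, cW v ≠ 0)
    (htV : ∀ v i, embedding_of_isReal v.2 (tV i) = cV v * signOf (εV v i) * DV v i ^ 2)
    (htW : ∀ v j, embedding_of_isReal v.2 (tW j) = cW v * signOf (εW v j) * DW v j ^ 2)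
    (hcc : ∀ v, cV v * cW v = ((wOf v).1.embedding δ).im)
    (hVd : IsUnit (Matrix.diagonal tV).det) (hWd : IsUnit (Matrix.diagonal tW).det)
    {Kk Pa : {v : InfinitePlace F // v.IsReal} → Type*} [∀ v, TopologicalSpace (Kk v)]
    [∀ v, TopologicalSpace (Pa v)] {κf : ∀ v, Kk v → UForm (R v) (S v)} {af : ∀ v, Pa v → UForm (R v) (S v)}
    (I : ∀ v, LeviKAKInput
      (fun u : UForm (R v) (S v) => (⇑((ι𝕎 (P v) (Q v) (R v) (S v) ((1 : UForm (P v) (Q v)), u)).1 :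
        ((DPIdx (P v) (Q v) (R v) (S v) → ℝ) × (DPIdx (P v) (Q v) (R v) (S v) → ℝ)) ≃ₗ[ℝ]
          ((DPIdx (P v) (Q v) (R v) (S v) → ℝ) × (DPIdx (P v) (Q v) (R v) (S v) → ℝ))) :
        PhaseMap (DPIdx (P v) (Q v) (R v) (S v))))
      (κf v) (af v))
    {s : UnitaryGroup.adelicPair F E c N M JV JW →* adelicMpCont F (Fin m)
      (GelbartRogawski1991.UnitaryDualPair.adelicGram F e (Matrix.diagonal tV) (Matrix.diagonal tW))}
    (hs : (GelbartRogawski1991.UnitaryDualPair.splittingDatum F E c N M e JV JW hcδ hδ hd hV hW hVd hWd hJV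
      hJW).IsCompatible s)
    (hsc : Continuous s)
    (q : adelicMpCont F (Fin m)
      (GelbartRogawski1991.UnitaryDualPair.adelicGram F e (Matrix.diagonal tV) (Matrix.diagonal tW)))
    (Φ : piSchwartzBruhat F (Fin m)) {C : Set (UnitaryGroup.adelic F E c M JW)} (hC : IsCompact C) :
    ∃ Φ₀ : (Fin m → AdeleRing (𝓞 F) F) → ℂ, Φ₀ ∈ piSchwartzBruhat F (Fin m) ∧
      (∀ x, (Φ₀ x).im = 0 ∧ 0 ≤ (Φ₀ x).re) ∧
        ∀ u ∈ C, ∀ x, ‖((adelicMpCont.omega F (Fin m)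
          (GelbartRogawski1991.UnitaryDualPair.adelicGram F e (Matrix.diagonal tV) (Matrix.diagonal tW))
          (q * GelbartRogawski1991.UnitaryDualPair.pairSplitting F E c N M e JV JW s (1, u) * q⁻¹) Φ :
            piSchwartzBruhat F (Fin m)) : (Fin m → AdeleRing (𝓞 F) F) → ℂ) x‖ ≤ (Φ₀ x).re :=
  exists_piSchwartzBruhat_dominating_omega_conj_comp_of_kakData
    (GelbartRogawski1991.UnitaryDualPair.isUnit_adelicGram F e hVd hWd)
    ((GelbartRogawski1991.UnitaryDualPair.pairSplitting F E c N M e JV JW s).comp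
      (MonoidHom.inr (UnitaryGroup.adelic F E c N JV) (UnitaryGroup.adelic F E c M JW)))
    ((GelbartRogawski1991.UnitaryDualPair.continuous_pairSplitting F E c N M e JV JW hsc).comp
      (continuous_const.prodMk continuous_id))
    (scaledFrame F (Fin m) (pairScale N M (e := e) DV DW) (pairScale_ne_zero N M hDV0 hDW0))
    (isUnit_archMat_of_isUnit _ (GelbartRogawski1991.UnitaryDualPair.isUnit_adelicGram F e hVd hWd))
    (kakImplementerData_leviFamily_places_reindex (fun v => pairFrame (P v) (Q v) (R v) (S v) e (εV v) (εW v)) I)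
    (fun u v => (archPairPlace E c N M hc wOf hw hover tV tW hJV hJW εV εW hDV0 hDW0 hcV hcW htV htW v (1, u)).2)
    (continuous_pi fun v => continuous_snd.comp
      ((continuous_archPairPlace E c N M hc wOf hw hover tV tW hJV hJW εV εW hDV0 hDW0 hcV hcW htV htW v).comp
        (continuous_const.prodMk continuous_id)))
    (fun u => archPhaseMap_proj_pairSplitting_one_left E c N M e tV tW hJV hJW hcδ hδ hd hV hW hc wOf hw hover εV
      εW hDV0 hDW0 hcV hcW htV htW hcc hVd hWd hs u)
    q Φ hC

/-- **Lemme 5 for the second factor in a conjugated polarisation, from ONE SIGN FACT ON `t_W` PER REAL PLACE — the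
consumer's form (no frames, no scalings, no `KAK` data, nothing on `t_V`; `q ∈ Mp_ψ(𝕎_𝔸)ᶜᵒⁿᵗ` fixed).**  Hypothesis: at every real place `v` of `F`, all but at most one of the
real numbers `σ_v(t_W j)` have a common strict sign (`U(W_v)` of real rank `≤ 1`: signature `(M,0)`, `(0,M)`,
`(M−1,1)` or `(1,M−1)`); `V` is ARBITRARY.  Conclusion: on every compact `C ⊆ U(J_W)(𝔸_F)` the functions
`ω_ψ(q · s_pair(1, u) · q⁻¹)Φ`, `u ∈ C`, are dominated by ONE real non-negative `Φ₀ ∈ 𝒮(𝔸_Fⁿ)`.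
[cite: Weil1964, Chap. III n° 41, Lemme 5 p. 194]
[cite: Weil1965, Chap. V n° 47, n° 50]
[cite: GelbartRogawski1991, §3.1 Prop. 3.1.1 p. 455]
[cite: KonnoKonno2007, §3.1 (3.1)]
[cite: MoeglinVignerasWaldspurger1987, Ch. 1 I.17]
[cite: Folland1989, §4.2 (4.24)–(4.26) pp. 177–178, Prop. (4.39) pp. 183–184]
[cite: Knapp2002, Thm 7.39] -/
theorem exists_piSchwartzBruhat_dominating_omega_conj_pairSplitting_inr_of_signs (hc : c ≠ 1)
    (wOf : {v : InfinitePlace F // v.IsReal} → {w : InfinitePlace E // w.IsComplex})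
    (hw : ∀ v, c • (wOf v).1 = (wOf v).1) (hover : ∀ v, (wOf v).1.comap (algebraMap F E) = v.1)
    (hVd : IsUnit (Matrix.diagonal tV).det) (hWd : IsUnit (Matrix.diagonal tW).det)
    (hrk : ∀ v : {v : InfinitePlace F // v.IsReal}, ∃ j₀ : Fin M,
      (∀ j, j ≠ j₀ → 0 < embedding_of_isReal v.2 (tW j)) ∨ ∀ j, j ≠ j₀ → embedding_of_isReal v.2 (tW j) < 0)
    {s : UnitaryGroup.adelicPair F E c N M JV JW →* adelicMpCont F (Fin m)
      (GelbartRogawski1991.UnitaryDualPair.adelicGram F e (Matrix.diagonal tV) (Matrix.diagonal tW))}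
    (hs : (GelbartRogawski1991.UnitaryDualPair.splittingDatum F E c N M e JV JW hcδ hδ hd hV hW hVd hWd hJV
      hJW).IsCompatible s)
    (hsc : Continuous s)
    (q : adelicMpCont F (Fin m)
      (GelbartRogawski1991.UnitaryDualPair.adelicGram F e (Matrix.diagonal tV) (Matrix.diagonal tW)))
    (Φ : piSchwartzBruhat F (Fin m)) {C : Set (UnitaryGroup.adelic F E c M JW)} (hC : IsCompact C) :
    ∃ Φ₀ : (Fin m → AdeleRing (𝓞 F) F) → ℂ, Φ₀ ∈ piSchwartzBruhat F (Fin m) ∧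
      (∀ x, (Φ₀ x).im = 0 ∧ 0 ≤ (Φ₀ x).re) ∧
        ∀ u ∈ C, ∀ x, ‖((adelicMpCont.omega F (Fin m)
          (GelbartRogawski1991.UnitaryDualPair.adelicGram F e (Matrix.diagonal tV) (Matrix.diagonal tW))
          (q * GelbartRogawski1991.UnitaryDualPair.pairSplitting F E c N M e JV JW s (1, u) * q⁻¹) Φ :
            piSchwartzBruhat F (Fin m)) : (Fin m → AdeleRing (𝓞 F) F) → ℂ) x‖ ≤ (Φ₀ x).re := by
  have hδv : ∀ v : {v : InfinitePlace F // v.IsReal}, ((wOf v).1.embedding δ).im ≠ 0 := fun v =>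
    UnitaryGroup.im_embedding_delta_ne_zero F E c (wOf v) (hw v) hc hcδ hδ
  have htV0 : ∀ (v : {v : InfinitePlace F // v.IsReal}) i, embedding_of_isReal v.2 (tV i) ≠ 0 := fun v i =>
    (map_ne_zero _).2 (ne_zero_of_isUnit_det_diagonal hVd i)
  have htW0 : ∀ (v : {v : InfinitePlace F // v.IsReal}) j, embedding_of_isReal v.2 (tW j) ≠ 0 := fun v j =>
    (map_ne_zero _).2 (ne_zero_of_isUnit_det_diagonal hWd j)
  choose j₀ hj₀ using hrk
  -- the sign convention on the first factor: `c_V(v) := ± im σ_{w(v)}(δ)`, so that `c_W(v) = im σ_{w(v)}(δ)/c_V(v) = ±1`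
  -- makes `σ_v(t_W j) / c_W(v)` positive off `j₀ v`; `V` is split by whatever signs result (no condition).
  let cV : {v : InfinitePlace F // v.IsReal} → ℝ := fun v =>
    if ∀ j, j ≠ j₀ v → 0 < embedding_of_isReal v.2 (tW j) then ((wOf v).1.embedding δ).im
    else -((wOf v).1.embedding δ).im
  have hcV : ∀ v, cV v ≠ 0 := fun v => by
    by_cases h : ∀ j, j ≠ j₀ v → 0 < embedding_of_isReal v.2 (tW j)
    · simp only [cV, if_pos h]; exact hδv v
    · simp only [cV, if_neg h]; exact neg_ne_zero.2 (hδv v)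
  have hy : ∀ v, ∃ j₁, ∀ j, j ≠ j₁ →
      0 < placeSignVec tW (fun v => ((wOf v).1.embedding δ).im / cV v) v j := fun v => by
    refine ⟨j₀ v, fun j hj => ?_⟩
    show 0 < embedding_of_isReal v.2 (tW j) / (((wOf v).1.embedding δ).im / cV v)
    by_cases h : ∀ j, j ≠ j₀ v → 0 < embedding_of_isReal v.2 (tW j)
    · have hc1 : ((wOf v).1.embedding δ).im / cV v = 1 := by simp only [cV, if_pos h]; exact div_self (hδv v)
      rw [hc1, div_one]
      exact h j hj
    · have hc1 : ((wOf v).1.embedding δ).im / cV v = -1 := by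
        simp only [cV, if_neg h]; rw [div_neg, div_self (hδv v)]
      rw [hc1, div_neg, div_one, neg_pos]
      exact ((hj₀ v).resolve_left h) j hj
  exact exists_piSchwartzBruhat_dominating_omega_conj_pairSplitting_inr E c N M e tV tW hJV hJW hcδ hδ hd hV hW hc
    wOf hw hover (fun v => signSplit (placeSignVec tV cV v))
    (fun v => signSplit (placeSignVec tW (fun v => ((wOf v).1.embedding δ).im / cV v) v))
    (DV := fun v => sqrtAbs (placeSignVec tV cV v))
    (DW := fun v => sqrtAbs (placeSignVec tW (fun v => ((wOf v).1.embedding δ).im / cV v) v))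
    (fun v i => sqrtAbs_ne_zero (div_ne_zero (htV0 v i) (hcV v)))
    (fun v j => sqrtAbs_ne_zero (div_ne_zero (htW0 v j) (div_ne_zero (hδv v) (hcV v))))
    (cV := cV) (cW := fun v => ((wOf v).1.embedding δ).im / cV v) hcV
    (fun v => div_ne_zero (hδv v) (hcV v))
    (fun v i => eq_mul_signOf_signSplit_mul_sqrtAbs_sq (hcV v) (fun j => embedding_of_isReal v.2 (tV j)) i
      (htV0 v i))
    (fun v j => eq_mul_signOf_signSplit_mul_sqrtAbs_sq (div_ne_zero (hδv v) (hcV v))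
      (fun j => embedding_of_isReal v.2 (tW j)) j (htW0 v j))
    (fun v => by rw [← mul_div_assoc, mul_div_cancel_left₀ _ (hcV v)]) hVd hWd
    (fun v => (Classical.choice (nonempty_anyLeviKAKInput_inr_of_signs (placeSignVec tV cV v)
      (Or.inl (hy v)))).input) hs hsc q Φ hC

end Pair

/-! ## §2 The CM pin, conjugated polarisation -/

section CM

variable (L : Type) [Field L] [NumberField L] [IsCMField L] {N M n : ℕ} (e : Fin N × Fin M ≃ Fin n)
  (dV : Fin N → L) (hdV : ∀ i, IsCMField.complexConj L (dV i) = dV i) (hdV0 : ∀ i, dV i ≠ 0)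
  (dW : Fin M → L) (hdW : ∀ i, IsCMField.complexConj L (dW i) = dW i) (hdW0 : ∀ i, dW i ≠ 0)

/-- the sign fact through complex embeddings gives the sign fact at every real place of `L⁺` (read through THE
complex place over it, `embedding_of_isReal_cmRealVec`). [folklore] -/
private theorem rank_of_embeddings
    (hWr : ∀ τ : L →+* ℂ, ∃ j₀ : Fin M, (∀ j, j ≠ j₀ → 0 < (τ (dW j)).re) ∨ ∀ j, j ≠ j₀ → (τ (dW j)).re < 0)
    (v : {v : InfinitePlace ↥(maximalRealSubfield L) // v.IsReal}) :
    ∃ j₀ : Fin M, (∀ j, j ≠ j₀ → 0 < embedding_of_isReal v.2 (cmRealVec L dW hdW j)) ∨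
      ∀ j, j ≠ j₀ → embedding_of_isReal v.2 (cmRealVec L dW hdW j) < 0 := by
  have hτ : (InfinitePlace.mk (cmPlaceOver L v).1.embedding).comap (algebraMap (↥(maximalRealSubfield L)) L) =
      v.1 := by
    rw [mk_embedding]; exact cmPlaceOver_comap L v
  have hre : ∀ j, embedding_of_isReal v.2 (cmRealVec L dW hdW j) = ((cmPlaceOver L v).1.embedding (dW j)).re :=
    fun j => by rw [← embedding_of_isReal_cmRealVec L v _ hτ dW hdW j, Complex.ofReal_re]
  obtain ⟨j₀, h⟩ := hWr (cmPlaceOver L v).1.embedding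
  refine ⟨j₀, h.imp (fun h j hj => ?_) fun h j hj => ?_⟩ <;> rw [hre] <;> exact h j hj

/-- **Lemme 5 for the second factor at the CM pin**: under the same sign fact on `d_W` (nothing on `d_V`), for every
`Φ ∈ 𝒮(𝔸ⁿ)` and every compact `C ⊆ U(diag d_W)(𝔸_{L⁺})` ONE real non-negative `Φ₀ ∈ 𝒮(𝔸ⁿ)` dominates all
`ω_ψ(q · s_pair(1, u) · q⁻¹)Φ`, `u ∈ C` (`q ∈ Mp` fixed).
[cite: Weil1964, Chap. III n° 41, Lemme 5 p. 194]
[cite: Weil1965, Chap. V n° 47, n° 50]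
[cite: GelbartRogawski1991, §3.1 Prop. 3.1.1 p. 455]
[cite: KonnoKonno2007, §3.1 (3.1)]
[cite: MoeglinVignerasWaldspurger1987, Ch. 1 I.17]
[cite: Folland1989, §4.2 (4.24)–(4.26) pp. 177–178, Prop. (4.39) pp. 183–184]
[cite: Knapp2002, Thm 7.39] -/
theorem exists_piSchwartzBruhat_dominating_conj_cmPairSplitting_inr_of_signs
    (hGR : (GelbartRogawski1991.UnitaryDualPair.cmSplittingDatum L e dV hdV hdV0 dW hdW hdW0).CompatibleSplitting)
    (hWr : ∀ τ : L →+* ℂ, ∃ j₀ : Fin M, (∀ j, j ≠ j₀ → 0 < (τ (dW j)).re) ∨ ∀ j, j ≠ j₀ → (τ (dW j)).re < 0)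
    (q : adelicMpCont (↥(maximalRealSubfield L)) (Fin n)
      (GelbartRogawski1991.UnitaryDualPair.adelicGram (↥(maximalRealSubfield L)) e
        (GelbartRogawski1991.UnitaryDualPair.realDiagonal L dV hdV)
        (GelbartRogawski1991.UnitaryDualPair.realDiagonal L dW hdW)))
    (Φ : piSchwartzBruhat (↥(maximalRealSubfield L)) (Fin n))
    {C : Set ↥(UnitaryGroup.adelic (↥(maximalRealSubfield L)) L (IsCMField.complexConj L) M (Matrix.diagonal dW))}
    (hC : IsCompact C) :
    ∃ Φ₀ : (Fin n → AdeleRing (𝓞 ↥(maximalRealSubfield L)) ↥(maximalRealSubfield L)) → ℂ,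
      Φ₀ ∈ piSchwartzBruhat (↥(maximalRealSubfield L)) (Fin n) ∧ (∀ x, (Φ₀ x).im = 0 ∧ 0 ≤ (Φ₀ x).re) ∧
        ∀ u ∈ C, ∀ x, ‖((adelicMpCont.omega (↥(maximalRealSubfield L)) (Fin n)
          (GelbartRogawski1991.UnitaryDualPair.adelicGram (↥(maximalRealSubfield L)) e
            (GelbartRogawski1991.UnitaryDualPair.realDiagonal L dV hdV)
            (GelbartRogawski1991.UnitaryDualPair.realDiagonal L dW hdW))
          (q * GelbartRogawski1991.UnitaryDualPair.cmPairSplitting L e dV hdV hdV0 dW hdW hdW0 hGR (1, u) * q⁻¹) Φ :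
            piSchwartzBruhat (↥(maximalRealSubfield L)) (Fin n)) :
              (Fin n → AdeleRing (𝓞 ↥(maximalRealSubfield L)) ↥(maximalRealSubfield L)) → ℂ) x‖ ≤ (Φ₀ x).re :=
  exists_piSchwartzBruhat_dominating_omega_conj_pairSplitting_inr_of_signs L (IsCMField.complexConj L) N M e
    (cmRealVec L dV hdV) (cmRealVec L dW hdW) (GelbartRogawski1991.UnitaryDualPair.realDiagonal_map L dV hdV).symm
    (GelbartRogawski1991.UnitaryDualPair.realDiagonal_map L dW hdW).symm
    (GelbartRogawski1991.UnitaryDualPair.complexConj_imagUnit L)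
    (GelbartRogawski1991.UnitaryDualPair.imagUnit_ne_zero L)
    (GelbartRogawski1991.UnitaryDualPair.imagUnit_mul_self L)
    (GelbartRogawski1991.UnitaryDualPair.realDiagonal_isSymm L dV hdV)
    (GelbartRogawski1991.UnitaryDualPair.realDiagonal_isSymm L dW hdW)
    (IsCMField.complexConj_ne_one L) (cmPlaceOver L) (cmPlaceOver_smul L) (cmPlaceOver_comap L)
    (GelbartRogawski1991.UnitaryDualPair.isUnit_det_realDiagonal L dV hdV hdV0)
    (GelbartRogawski1991.UnitaryDualPair.isUnit_det_realDiagonal L dW hdW hdW0)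
    (rank_of_embeddings L dW hdW hWr)
    (GelbartRogawski1991.UnitaryDualPair.splittingOf_isCompatible _ _ _ _ _ _ _ _ _ _ _ _ _ _ _ _ _ hGR)
    (GelbartRogawski1991.UnitaryDualPair.continuous_splittingOf _ _ _ _ _ _ _ _ _ _ _ _ _ _ _ _ _ hGR) q Φ hC

end CM

/-! ## §3 A hermitian PLANE (`M = 2`), conjugated polarisation: no sign hypothesis at all -/

section CMPlane

variable (L : Type) [Field L] [NumberField L] [IsCMField L] {N n : ℕ} (e : Fin N × Fin 2 ≃ Fin n)
  (dV : Fin N → L) (hdV : ∀ i, IsCMField.complexConj L (dV i) = dV i) (hdV0 : ∀ i, dV i ≠ 0)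
  (dW : Fin 2 → L) (hdW : ∀ i, IsCMField.complexConj L (dW i) = dW i) (hdW0 : ∀ i, dW i ≠ 0)

include hdW hdW0 in
/-- a non-degenerate real BINARY form has real rank `≤ 1`: with `j₀ := 1` the condition is the sign of `τ(d_W 0)`.
[folklore] -/
private theorem rank_two (τ : L →+* ℂ) :
    ∃ j₀ : Fin 2, (∀ j, j ≠ j₀ → 0 < (τ (dW j)).re) ∨ ∀ j, j ≠ j₀ → (τ (dW j)).re < 0 := by
  refine ⟨1, ?_⟩
  rcases lt_or_gt_of_ne (re_apply_ne_zero_of_complexConj_eq L τ (hdW 0) (hdW0 0)) with h | h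
  · refine Or.inr fun j hj => ?_
    fin_cases j
    · exact h
    · exact absurd rfl hj
  · refine Or.inl fun j hj => ?_
    fin_cases j
    · exact h
    · exact absurd rfl hj

/-- **Lemme 5 for the second factor, `W` a hermitian PLANE — the (DOM-C) letter of the Siegel–Weil engine**: for the
CM dual pair `(U(diag d_V), U(diag d_W))` with `W` a plane (ANY `d_V`, ANY non-degenerate `d_W`: no sign
hypothesis), every `Φ ∈ 𝒮(𝔸ⁿ)` and every compact `C ⊆ U(diag d_W)(𝔸_{L⁺})`, ONE real non-negative `Φ₀ ∈ 𝒮(𝔸ⁿ)`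
satisfies `‖(ω_ψ(q · s_pair(1, u) · q⁻¹)Φ)(x)‖ ≤ (Φ₀ x).re` for all `u ∈ C`, `x ∈ 𝔸ⁿ` — for EVERY fixed `q ∈ Mp_ψ(𝕎_𝔸)ᶜᵒⁿᵗ` (e.g. a lift of Li's `δ♮`: the family the Siegel–Weil boundedness argument consumes, [Weil1965, n° 50]).
[cite: Weil1964, Chap. III n° 41, Lemme 5 p. 194]
[cite: Weil1965, Chap. V n° 47, n° 50]
[cite: GelbartRogawski1991, §3.1 Prop. 3.1.1 p. 455]
[cite: KonnoKonno2007, §3.1 (3.1)]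
[cite: MoeglinVignerasWaldspurger1987, Ch. 1 I.17]
[cite: Folland1989, §4.2 (4.24)–(4.26) pp. 177–178, Prop. (4.39) pp. 183–184]
[cite: Knapp2002, Thm 7.39] -/
theorem exists_piSchwartzBruhat_dominating_conj_cmPairSplitting_inr_two
    (hGR : (GelbartRogawski1991.UnitaryDualPair.cmSplittingDatum L e dV hdV hdV0 dW hdW hdW0).CompatibleSplitting)
    (q : adelicMpCont (↥(maximalRealSubfield L)) (Fin n)
      (GelbartRogawski1991.UnitaryDualPair.adelicGram (↥(maximalRealSubfield L)) e
        (GelbartRogawski1991.UnitaryDualPair.realDiagonal L dV hdV)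
        (GelbartRogawski1991.UnitaryDualPair.realDiagonal L dW hdW)))
    (Φ : piSchwartzBruhat (↥(maximalRealSubfield L)) (Fin n))
    {C : Set ↥(UnitaryGroup.adelic (↥(maximalRealSubfield L)) L (IsCMField.complexConj L) 2 (Matrix.diagonal dW))}
    (hC : IsCompact C) :
    ∃ Φ₀ : (Fin n → AdeleRing (𝓞 ↥(maximalRealSubfield L)) ↥(maximalRealSubfield L)) → ℂ,
      Φ₀ ∈ piSchwartzBruhat (↥(maximalRealSubfield L)) (Fin n) ∧ (∀ x, (Φ₀ x).im = 0 ∧ 0 ≤ (Φ₀ x).re) ∧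
        ∀ u ∈ C, ∀ x, ‖((adelicMpCont.omega (↥(maximalRealSubfield L)) (Fin n)
          (GelbartRogawski1991.UnitaryDualPair.adelicGram (↥(maximalRealSubfield L)) e
            (GelbartRogawski1991.UnitaryDualPair.realDiagonal L dV hdV)
            (GelbartRogawski1991.UnitaryDualPair.realDiagonal L dW hdW))
          (q * GelbartRogawski1991.UnitaryDualPair.cmPairSplitting L e dV hdV hdV0 dW hdW hdW0 hGR (1, u) * q⁻¹) Φ :
            piSchwartzBruhat (↥(maximalRealSubfield L)) (Fin n)) :
              (Fin n → AdeleRing (𝓞 ↥(maximalRealSubfield L)) ↥(maximalRealSubfield L)) → ℂ) x‖ ≤ (Φ₀ x).re :=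
  exists_piSchwartzBruhat_dominating_conj_cmPairSplitting_inr_of_signs L e dV hdV hdV0 dW hdW hdW0 hGR
    (rank_two L dW hdW hdW0) q Φ hC

end CMPlane

end Literature.NumberTheory.Weil1964

end
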